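import Literature.MathematicalPhysics.QuantumFieldTheory.WightmanProofs
import Literature.MathematicalPhysics.QuantumFieldTheory.OSSpectralSupport
import Literature.MathematicalPhysics.QuantumFieldTheory.OSLocalityEdgeGrowth
import Literature.MathematicalPhysics.QuantumFieldTheory.WightmanPositivityProofs

/-!
# Discharge of named literature fact(s) by composition

This file only composes reductions and discharges that are already in the tree
(no new definitions, no new named facts): each `theorem X_holds : X` below feeds the
proved hypotheses into an existing reduction theorem.  Net effect: the listed facts
stop being literature debt.
-/

namespace Literature.MathematicalPhysics.QuantumFieldTheory

/-- Discharge of `OS1973_isWightmanFamily_of_continuation` (Osterwalder–Schrader 1973: the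
analytically continued Schwinger functions form a Wightman family) by feeding the six proved
parts — Lorentz invariance, spectral condition, hermiticity, locality, positive definiteness and
cluster property — into `OS1973_isWightmanFamily_of_continuation_of_parts`.
[cite: OsterwalderSchraderCMP1973, §4.1 (p. 93, R0 and R5) and §§4.2–4.5 (R1–R4)] -/
theorem OS1973_isWightmanFamily_of_continuation_holds :
    OS1973_isWightmanFamily_of_continuation :=
  OS1973_isWightmanFamily_of_continuation_of_parts OS1973_lorentzInvariant_holds
    OS1973_spectralCondition_holds OS1973_hermitian_holds OS1973_local_holds
    OS1973_positiveDefinite_holds OS1973_cluster_holds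

end Literature.MathematicalPhysics.QuantumFieldTheory
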